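import Summits.BirchSwinnertonDyer.BirchSwinnertonDyer.Theorems.ByReductionTypeAtTwoFineSelmerConjAAtTwoAdditivePotGoodCubicDiscriminant
import HarnessLib

/-!
# Route `ByReductionTypeAtTwo` (rung K4), crux C1″ `FineSelmerConjAAtTwoAdditivePotGood` (item stmt-BirchSwinnertonDyer-22615):
# THE CLASS-NUMBER-ONE DOOR — the FIRST UNCONDITIONAL `S₃`-cubic instances of Iwasawa's `μ₂ = 0` in the tree
# (`ℚ(θ)` with `θ³ = θ + 1`, `θ³ = 1 − θ`, and the Eisenstein cubic `X³ − 4X² + 6X − 2`: discriminants `−23, −31, −44`), and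
# Coates–Sujatha (A)₂ for every elliptic curve with one of these `2`-torsion fields, modulo Lim 2017 Thm. 3.5 ALONE
# (a `--supports 22615` file; seat `bsd-2adic-k4-w1` GEN 4; sequel of `…UniquePrimeDoor`/`…InertDoor`/`…EisensteinDoor`/
# `…CubicDiscriminant`)

HONEST FRAMING (cell `bsd-2adic`, D-0036/D-0054): types-the-object-of; closes nothing at the `∀`-level (C1″ ⟺ Iwasawa's
`μ₂`-conjecture for ALL `S₃`-cubics, `…CurveFreeIff`); nothing booked; BSD is not proved by any of this. §1–§2 are UNCONDITIONAL
KERNEL THEOREMS (no named fact, no displayed datum); §3 is conditional on ONE named fact, `hLim2` = Lim 2017 Thm. 3.5 + Lemma 3.2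
at `p = 2`, and on nothing else.

THE CHAIN (all kernel): parity of `(p, q, r)` ⟹ exactly one prime of `ℚ(β)` above `2` (`…InertDoor` / `…EisensteinDoor`);
`|disc| ≤ 45` ⟹ `h(ℚ(β)) = 1` (`…CubicDiscriminant`: `disc = m² d_K`, Minkowski); Iwasawa 1956 (discharged fact
`iwasawa1956_…_unique_prime_holds`) ⟹ `e_n = 0` for every layer of EVERY `ℤ₂`-extension of `ℚ(β)` ⟹ `μ₂ = 0` (growth form).

* §1 `classicalMuVanishes_two_adjoin_of_odd_of_abs_discr_le` (`r` odd, `p + q` odd, `|disc| ≤ 45`) and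
  `classicalMuVanishes_two_adjoin_of_eisenstein_of_abs_discr_le` (`p, q, r` even, `4 ∤ r`, `|disc| ≤ 45`): `μ₂ = 0` along EVERY
  `ℤ₂`-extension of `ℚ(β)`, NO hypothesis left.
* §2 THE THREE SMALLEST `S₃`-CUBIC FIELDS: **`classicalMuVanishes_cubicField_disc_neg23'`** (`X³ − X − 1`),
  **`classicalMuVanishes_cubicField_disc_neg31`** (`X³ + X − 1`), **`classicalMuVanishes_cubicField_disc_neg44`** (`X³ − 4X² + 6X − 2`):
  Iwasawa's `μ₂` vanishes along every `ℤ₂`-extension — UNCONDITIONAL. (`…CurveFreeHeart` §7 had «C1″ ⟹ `μ₂(ℚ(θ_{−23})) = 0`» as a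
  refutation handle; that handle is now settled on the `μ₂ = 0` side by the kernel.)
* §3 (A)₂ modulo `hLim2` ALONE: `fineSelmerDual_moduleFinite_two_of_odd_cubic_pointField_of_abs_discr_le` (any `W/ℚ`, any `P ≠ 0` in
  `W[2]` with `ℚ(P) = ℚ(β)`), its Eisenstein twin, and the cubic models **`y² = x³ − x − 1`**, **`y² = x³ + x − 1`**,
  **`y² = x³ − 4x² + 6x − 2`** (`conjA_two_cubicModel_disc_neg23/31/44`): Coates–Sujatha Conjecture A at `p = 2` for these `S₃`-image
  curves follows from Lim's printed theorem and nothing else — the first such instances on the additive/`S₃` side of K4.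

References: [Greenberg2001IwasawaPastPresent] Prop. 2.1 p. 339; [Washington1997] Prop. 13.22; [Lim2017FineSelmer] Thm. 3.5, Lemma 3.2;
[CoatesSujatha2005] (A); [Marcus1977] Ch. 5 (Minkowski); [Cohen1993] App. B Table B.4 (d = −23, −31, −44: h = 1).
-/

set_option autoImplicit false
-- sibling precedent (`…CubicDiscriminant.lean`): the directory name repeats the summit name
set_option linter.dupNamespace false

noncomputable section

open scoped Classical IntermediateField NumberField

namespace Summit.BirchSwinnertonDyer.BirchSwinnertonDyer.Theorems.AddKatoTwo

open WeierstrassCurve Field Polynomial IsDedekindDomain Literature.NumberTheory.EllipticCurves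
  Literature.NumberTheory.GaloisRepresentations
  Literature.NumberTheory.IwasawaTheory
  Summit.BirchSwinnertonDyer.BirchSwinnertonDyer.Theorems.AlignedTransportAtTwoTorsionPointField
  Summit.BirchSwinnertonDyer.BirchSwinnertonDyer.Theses.ByReductionTypeAtTwo

/-! ## §1 `μ₂ = 0` for `ℚ(β)` with NO hypothesis left: parity + small discriminant -/

section General

variable {p q r : ℤ}

/-- **`μ₂ = 0` UNCONDITIONALLY on the small inert block**: for `p q r : ℤ` with `r` odd, `p + q` odd and `|disc(X³ + pX² + qX + r)| ≤ 45`,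
every root `β ∈ ℚ̄` and EVERY `ℤ₂`-extension `κ` of `ℚ(β)`: Iwasawa's classical `μ`-invariant of `κ` vanishes (growth form).
(`2` inert by `…InertDoor`, `h = 1` by `…CubicDiscriminant`, then Iwasawa 1956.) KERNEL, no named fact.
[cite: Greenberg2001IwasawaPastPresent, Prop. 2.1 p. 339] [cite: Marcus1977, Ch. 5 Cor. 2 of Thm. 37] -/
theorem classicalMuVanishes_two_adjoin_of_odd_of_abs_discr_le (hr : Odd r) (hpq : Odd (p + q))
    (hsmall : |Cubic.discr ⟨1, p, q, r⟩| ≤ 45) {β : AlgebraicClosure ℚ}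
    (hβ : aeval β (Cubic.toPoly ⟨1, (p : ℚ), q, r⟩) = 0) (κ : ZpExtension (IntermediateField.adjoin ℚ {β}) 2) :
    ClassicalMuVanishes κ :=
  classicalMuVanishes_two_adjoin_of_odd hr hpq hβ
    (not_two_dvd_card_classGroup_adjoin_of_abs_discr_le (irreducible_cubic_of_odd hr hpq) hsmall hβ) κ

/-- **`μ₂ = 0` UNCONDITIONALLY on the small Eisenstein block**: `p, q, r` even, `4 ∤ r`, `|disc| ≤ 45`, any root `β`, EVERY
`ℤ₂`-extension of `ℚ(β)`. KERNEL, no named fact. [cite: Greenberg2001IwasawaPastPresent, Prop. 2.1 p. 339] [cite: Marcus1977, Ch. 5 Cor. 2 of Thm. 37] -/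
theorem classicalMuVanishes_two_adjoin_of_eisenstein_of_abs_discr_le (hp : Even p) (hq : Even q) (hr : Even r)
    (hr4 : ¬ (4 : ℤ) ∣ r) (hsmall : |Cubic.discr ⟨1, p, q, r⟩| ≤ 45) {β : AlgebraicClosure ℚ}
    (hβ : aeval β (Cubic.toPoly ⟨1, (p : ℚ), q, r⟩) = 0) (κ : ZpExtension (IntermediateField.adjoin ℚ {β}) 2) :
    ClassicalMuVanishes κ :=
  classicalMuVanishes_two_adjoin_of_eisenstein hp hq hr hr4 hβ
    (not_two_dvd_card_classGroup_adjoin_of_abs_discr_le (irreducible_cubic_of_eisenstein hp hq hr hr4) hsmall hβ) κ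

/-- Strong form on the small inert block: `e_n = ord₂ #Cl(𝓞 ℚ(β)_n) = 0` for every layer of every `ℤ₂`-extension. KERNEL.
[cite: Greenberg2001IwasawaPastPresent, Prop. 2.1 p. 339] -/
theorem classNumberPExp_eq_zero_adjoin_of_odd_of_abs_discr_le (hr : Odd r) (hpq : Odd (p + q))
    (hsmall : |Cubic.discr ⟨1, p, q, r⟩| ≤ 45) {β : AlgebraicClosure ℚ}
    (hβ : aeval β (Cubic.toPoly ⟨1, (p : ℚ), q, r⟩) = 0) (κ : ZpExtension (IntermediateField.adjoin ℚ {β}) 2) (n : ℕ) :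
    classNumberPExp κ n = 0 :=
  classNumberPExp_eq_zero_adjoin_of_odd hr hpq hβ
    (not_two_dvd_card_classGroup_adjoin_of_abs_discr_le (irreducible_cubic_of_odd hr hpq) hsmall hβ) κ n

end General

/-! ## §2 The three smallest `S₃`-cubic fields: `μ₂ = 0`, UNCONDITIONAL -/

section Instances

/-- **Iwasawa's `μ₂ = 0` for the cubic field of discriminant `−23`** (`ℚ(θ)`, `θ³ = θ + 1`, the smallest cubic field; `2` inert,
`h = 1`): along EVERY `ℤ₂`-extension of `ℚ(θ)`, for every root `θ ∈ ℚ̄` of `X³ − X − 1`, the classical `μ`-invariant vanishes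
(growth form; indeed `e_n = 0` for all `n`). UNCONDITIONAL KERNEL THEOREM — an `S₃`-cubic instance of Iwasawa's `μ`-conjecture
at `ℓ = 2`, i.e. one field's worth of the curve-free form of C1″. [cite: Greenberg2001IwasawaPastPresent, Prop. 2.1 p. 339]
[cite: Cohen1993, App. B Table B.4 (d = −23)] -/
theorem classicalMuVanishes_cubicField_disc_neg23' {θ : AlgebraicClosure ℚ}
    (hθ : aeval θ (Cubic.toPoly ⟨1, ((0 : ℤ) : ℚ), ((-1 : ℤ) : ℚ), ((-1 : ℤ) : ℚ)⟩) = 0)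
    (κ : ZpExtension (IntermediateField.adjoin ℚ {θ}) 2) : ClassicalMuVanishes κ :=
  classicalMuVanishes_two_adjoin_of_odd_of_abs_discr_le (p := 0) (q := -1) (r := -1) (by decide) (by decide)
    (by simp only [Cubic.discr]; norm_num) hθ κ

/-- **Iwasawa's `μ₂ = 0` for the cubic field of discriminant `−31`** (`ℚ(θ)`, `θ³ + θ = 1`; `2` inert, `h = 1`): along EVERY
`ℤ₂`-extension, UNCONDITIONAL. [cite: Greenberg2001IwasawaPastPresent, Prop. 2.1 p. 339] [cite: Cohen1993, App. B Table B.4 (d = −31)] -/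
theorem classicalMuVanishes_cubicField_disc_neg31 {θ : AlgebraicClosure ℚ}
    (hθ : aeval θ (Cubic.toPoly ⟨1, ((0 : ℤ) : ℚ), ((1 : ℤ) : ℚ), ((-1 : ℤ) : ℚ)⟩) = 0)
    (κ : ZpExtension (IntermediateField.adjoin ℚ {θ}) 2) : ClassicalMuVanishes κ :=
  classicalMuVanishes_two_adjoin_of_odd_of_abs_discr_le (p := 0) (q := 1) (r := -1) (by decide) (by decide)
    (by simp only [Cubic.discr]; norm_num) hθ κ

/-- **Iwasawa's `μ₂ = 0` for the cubic field of discriminant `−44`** (`ℚ(θ)`, `θ³ − 4θ² + 6θ − 2 = 0`, i.e. `θ − 1` is a root of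
`X³ − X² + X + 1`; `2 = 𝔭³` by Eisenstein, `h = 1`): along EVERY `ℤ₂`-extension, UNCONDITIONAL.
[cite: Greenberg2001IwasawaPastPresent, Prop. 2.1 p. 339] [cite: Cohen1993, App. B Table B.4 (d = −44)] -/
theorem classicalMuVanishes_cubicField_disc_neg44 {θ : AlgebraicClosure ℚ}
    (hθ : aeval θ (Cubic.toPoly ⟨1, ((-4 : ℤ) : ℚ), ((6 : ℤ) : ℚ), ((-2 : ℤ) : ℚ)⟩) = 0)
    (κ : ZpExtension (IntermediateField.adjoin ℚ {θ}) 2) : ClassicalMuVanishes κ :=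
  classicalMuVanishes_two_adjoin_of_eisenstein_of_abs_discr_le (p := -4) (q := 6) (r := -2) (by decide) (by decide)
    (by decide) (by decide) (by simp only [Cubic.discr]; norm_num) hθ κ

end Instances

/-! ## §3 Coates–Sujatha (A)₂ modulo `hLim2` ALONE -/

section PerCurve

variable {p q r : ℤ}

/-- **(A)₂ modulo Lim 2017 Thm. 3.5 ALONE, small inert block**: for any elliptic `W/ℚ` and any non-zero `P ∈ W[2]` whose point field is
`ℚ(β)` for a root `β` of `X³ + pX² + qX + r` with `r` odd, `p + q` odd and `|disc| ≤ 45`, the dual fine Selmer group of `W` over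
`ℚ^{cyc}` is finitely generated over `ℤ₂` (`∃ γ D` currency of C1″). CONDITIONAL on `hLim2` only — no datum displayed.
[cite: Lim2017FineSelmer, §3 Thm. 3.5 and Lemma 3.2] [cite: CoatesSujatha2005, §3 statement (A)] -/
theorem fineSelmerDual_moduleFinite_two_of_odd_cubic_pointField_of_abs_discr_le
    (hLim2 : Lim2017.thm35_at_two_fineSelmerDual_moduleFinite_of_classicalMuVanishes_of_le_divisionField_four)
    (W : WeierstrassCurve ℚ) [W.IsElliptic] {P : geomTorsion W 2} (hP : P ≠ 0)
    (hr : Odd r) (hpq : Odd (p + q)) (hsmall : |Cubic.discr ⟨1, p, q, r⟩| ≤ 45)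
    {β : AlgebraicClosure ℚ} (hβ : aeval β (Cubic.toPoly ⟨1, (p : ℚ), q, r⟩) = 0)
    (hF : IntermediateField.fixedField (MulAction.stabilizer (absoluteGaloisGroup ℚ) P) = IntermediateField.adjoin ℚ {β})
    (κ : ZpExtension ℚ 2) (hκ : κ.IsCyclotomic) :
    ∃ (γ : absoluteGaloisGroup ℚ) (D : W.FineSelmerDualData κ γ),
      Module.Finite ℤ_[2] (RestrictScalars ℤ_[2] (IwasawaAlgebra 2) D.X) :=
  fineSelmerDual_moduleFinite_two_of_odd_cubic_pointField hLim2 W hP hr hpq hβ hF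
    (not_two_dvd_card_classGroup_adjoin_of_abs_discr_le (irreducible_cubic_of_odd hr hpq) hsmall hβ) κ hκ

/-- **(A)₂ modulo Lim 2017 Thm. 3.5 ALONE, small Eisenstein block** (`p, q, r` even, `4 ∤ r`, `|disc| ≤ 45`).
[cite: Lim2017FineSelmer, §3 Thm. 3.5 and Lemma 3.2] [cite: CoatesSujatha2005, §3 statement (A)] -/
theorem fineSelmerDual_moduleFinite_two_of_eisenstein_pointField_of_abs_discr_le
    (hLim2 : Lim2017.thm35_at_two_fineSelmerDual_moduleFinite_of_classicalMuVanishes_of_le_divisionField_four)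
    (W : WeierstrassCurve ℚ) [W.IsElliptic] {P : geomTorsion W 2} (hP : P ≠ 0)
    (hp : Even p) (hq : Even q) (hr : Even r) (hr4 : ¬ (4 : ℤ) ∣ r) (hsmall : |Cubic.discr ⟨1, p, q, r⟩| ≤ 45)
    {β : AlgebraicClosure ℚ} (hβ : aeval β (Cubic.toPoly ⟨1, (p : ℚ), q, r⟩) = 0)
    (hF : IntermediateField.fixedField (MulAction.stabilizer (absoluteGaloisGroup ℚ) P) = IntermediateField.adjoin ℚ {β})
    (κ : ZpExtension ℚ 2) (hκ : κ.IsCyclotomic) :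
    ∃ (γ : absoluteGaloisGroup ℚ) (D : W.FineSelmerDualData κ γ),
      Module.Finite ℤ_[2] (RestrictScalars ℤ_[2] (IwasawaAlgebra 2) D.X) :=
  fineSelmerDual_moduleFinite_two_of_eisenstein_pointField hLim2 W hP hp hq hr hr4 hβ hF
    (not_two_dvd_card_classGroup_adjoin_of_abs_discr_le (irreducible_cubic_of_eisenstein hp hq hr hr4) hsmall hβ) κ hκ

/-- `y² = x³ − x − 1` is an elliptic curve (`disc = −23 ≠ 0`). -/
theorem isElliptic_cubicModel_disc_neg23 :
    (⟨0, ((0 : ℤ) : ℚ), 0, ((-1 : ℤ) : ℚ), ((-1 : ℤ) : ℚ)⟩ : WeierstrassCurve ℚ).IsElliptic :=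
  isElliptic_cubicModel _ _ _ (by simp only [Cubic.discr]; norm_num)

/-- `y² = x³ + x − 1` is an elliptic curve (`disc = −31 ≠ 0`). -/
theorem isElliptic_cubicModel_disc_neg31 :
    (⟨0, ((0 : ℤ) : ℚ), 0, ((1 : ℤ) : ℚ), ((-1 : ℤ) : ℚ)⟩ : WeierstrassCurve ℚ).IsElliptic :=
  isElliptic_cubicModel _ _ _ (by simp only [Cubic.discr]; norm_num)

/-- `y² = x³ − 4x² + 6x − 2` is an elliptic curve (`disc = −44 ≠ 0`). -/
theorem isElliptic_cubicModel_disc_neg44 :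
    (⟨0, ((-4 : ℤ) : ℚ), 0, ((6 : ℤ) : ℚ), ((-2 : ℤ) : ℚ)⟩ : WeierstrassCurve ℚ).IsElliptic :=
  isElliptic_cubicModel _ _ _ (by simp only [Cubic.discr]; norm_num)

/-- **Coates–Sujatha Conjecture A at `p = 2` for `y² = x³ − x − 1`, modulo Lim 2017 Thm. 3.5 ALONE** (`2`-division field the
`S₃`-closure of the cubic field of discriminant `−23`): for the cyclotomic `ℤ₂`-extension the dual fine Selmer group is finitely
generated over `ℤ₂`. No certificate, no class-group datum, no other named fact. [cite: Lim2017FineSelmer, §3 Thm. 3.5 and Lemma 3.2]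
[cite: CoatesSujatha2005, §3 statement (A)] -/
theorem conjA_two_cubicModel_disc_neg23
    (hLim2 : Lim2017.thm35_at_two_fineSelmerDual_moduleFinite_of_classicalMuVanishes_of_le_divisionField_four)
    (κ : ZpExtension ℚ 2) (hκ : κ.IsCyclotomic) :
    haveI := isElliptic_cubicModel_disc_neg23
    ∃ (γ : absoluteGaloisGroup ℚ)
      (D : (⟨0, ((0 : ℤ) : ℚ), 0, ((-1 : ℤ) : ℚ), ((-1 : ℤ) : ℚ)⟩ : WeierstrassCurve ℚ).FineSelmerDualData κ γ),
      Module.Finite ℤ_[2] (RestrictScalars ℤ_[2] (IwasawaAlgebra 2) D.X) := by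
  haveI := isElliptic_cubicModel_disc_neg23
  obtain ⟨β, hβ⟩ : ∃ β : AlgebraicClosure ℚ, aeval β (Cubic.toPoly ⟨1, ((0 : ℤ) : ℚ), ((-1 : ℤ) : ℚ), ((-1 : ℤ) : ℚ)⟩) = 0 :=
    IsAlgClosed.exists_aeval_eq_zero _ _ (by rw [Cubic.degree_of_a_ne_zero one_ne_zero]; norm_num)
  exact fineSelmerDual_moduleFinite_two_cubicModel_of_odd hLim2 (p := 0) (q := -1) (r := -1) (by decide) (by decide) hβ
    (not_two_dvd_card_classGroup_adjoin_of_abs_discr_le (irreducible_cubic_of_odd (by decide) (by decide))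
      (by simp only [Cubic.discr]; norm_num) hβ) κ hκ

/-- **Conjecture A at `p = 2` for `y² = x³ + x − 1`, modulo Lim 2017 Thm. 3.5 ALONE** (cubic field of discriminant `−31`).
[cite: Lim2017FineSelmer, §3 Thm. 3.5 and Lemma 3.2] [cite: CoatesSujatha2005, §3 statement (A)] -/
theorem conjA_two_cubicModel_disc_neg31
    (hLim2 : Lim2017.thm35_at_two_fineSelmerDual_moduleFinite_of_classicalMuVanishes_of_le_divisionField_four)
    (κ : ZpExtension ℚ 2) (hκ : κ.IsCyclotomic) :
    haveI := isElliptic_cubicModel_disc_neg31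
    ∃ (γ : absoluteGaloisGroup ℚ)
      (D : (⟨0, ((0 : ℤ) : ℚ), 0, ((1 : ℤ) : ℚ), ((-1 : ℤ) : ℚ)⟩ : WeierstrassCurve ℚ).FineSelmerDualData κ γ),
      Module.Finite ℤ_[2] (RestrictScalars ℤ_[2] (IwasawaAlgebra 2) D.X) := by
  haveI := isElliptic_cubicModel_disc_neg31
  obtain ⟨β, hβ⟩ : ∃ β : AlgebraicClosure ℚ, aeval β (Cubic.toPoly ⟨1, ((0 : ℤ) : ℚ), ((1 : ℤ) : ℚ), ((-1 : ℤ) : ℚ)⟩) = 0 :=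
    IsAlgClosed.exists_aeval_eq_zero _ _ (by rw [Cubic.degree_of_a_ne_zero one_ne_zero]; norm_num)
  exact fineSelmerDual_moduleFinite_two_cubicModel_of_odd hLim2 (p := 0) (q := 1) (r := -1) (by decide) (by decide) hβ
    (not_two_dvd_card_classGroup_adjoin_of_abs_discr_le (irreducible_cubic_of_odd (by decide) (by decide))
      (by simp only [Cubic.discr]; norm_num) hβ) κ hκ

/-- **Conjecture A at `p = 2` for `y² = x³ − 4x² + 6x − 2`, modulo Lim 2017 Thm. 3.5 ALONE** (cubic field of discriminant `−44`,
`2` totally ramified). [cite: Lim2017FineSelmer, §3 Thm. 3.5 and Lemma 3.2] [cite: CoatesSujatha2005, §3 statement (A)] -/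
theorem conjA_two_cubicModel_disc_neg44
    (hLim2 : Lim2017.thm35_at_two_fineSelmerDual_moduleFinite_of_classicalMuVanishes_of_le_divisionField_four)
    (κ : ZpExtension ℚ 2) (hκ : κ.IsCyclotomic) :
    haveI := isElliptic_cubicModel_disc_neg44
    ∃ (γ : absoluteGaloisGroup ℚ)
      (D : (⟨0, ((-4 : ℤ) : ℚ), 0, ((6 : ℤ) : ℚ), ((-2 : ℤ) : ℚ)⟩ : WeierstrassCurve ℚ).FineSelmerDualData κ γ),
      Module.Finite ℤ_[2] (RestrictScalars ℤ_[2] (IwasawaAlgebra 2) D.X) := by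
  haveI := isElliptic_cubicModel_disc_neg44
  obtain ⟨β, hβ⟩ : ∃ β : AlgebraicClosure ℚ, aeval β (Cubic.toPoly ⟨1, ((-4 : ℤ) : ℚ), ((6 : ℤ) : ℚ), ((-2 : ℤ) : ℚ)⟩) = 0 :=
    IsAlgClosed.exists_aeval_eq_zero _ _ (by rw [Cubic.degree_of_a_ne_zero one_ne_zero]; norm_num)
  exact fineSelmerDual_moduleFinite_two_cubicModel_of_eisenstein hLim2 (p := -4) (q := 6) (r := -2) (by decide) (by decide)
    (by decide) (by decide) hβ
    (not_two_dvd_card_classGroup_adjoin_of_abs_discr_le (irreducible_cubic_of_eisenstein (by decide) (by decide) (by decide)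
      (by decide)) (by simp only [Cubic.discr]; norm_num) hβ) κ hκ

end PerCurve

end Summit.BirchSwinnertonDyer.BirchSwinnertonDyer.Theorems.AddKatoTwo

end
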